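import Literature.Computability.AlgebraicComplexity.CKSV22EsymSingularLocus
import Literature.Computability.AlgebraicComplexity.ABV17SingularLocusBound
import Mathlib.RingTheory.Localization.FractionRing
import Mathlib.RingTheory.Ideal.KrullsHeightTheorem
import HarnessLib

/-!
# Chatterjee–Kumar–She–Volk 2022, Lemma 21 (codimension of the singular locus of `ESYM(n,d)`), height form, and the determinantal-complexity corollary

P. Chatterjee, M. Kumar, A. She, B. L. Volk, *Quadratic lower bounds for algebraic branching programs
and formulas*, comput. complex. **31** (2022) 8 (arXiv:1911.11793), §5.1, **Lemma 21** (TeX L675–681,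
attributed to Meckler–Zaimi [MZ17] and Limaye–Mittal–Pareek [LMP19]): "Let `n, d ∈ ℕ` be natural
numbers with `2 ≤ d ≤ n`. Then, over any field of characteristic at least `d+1`, the dimension of
the variety `V = 𝕍({∂_{x_i} ESYM(n,d) : i ∈ [n]})` is at most `d − 2`." Printed derivation
(L689): "Claim 22 implies that the variety `V` is a subset of `∪_{S ⊆ [n], |S| = d−2} V_S`, where
`V_S` is the set of points where the coordinates in `S` are all set to zero … Thus, each `V_S` is a
variety of dimension `d−2` … Therefore, the dimension of `V` cannot exceed `d−2`." (As recorded in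
`CKSV22EsymSingularLocus`, the printed characteristic hypothesis does not suffice — Claim 22 is
false over `𝔽₃` for `(n,d) = (4,2)` — and the tree's `CKSV2022.claim_22` carries the corrected
hypothesis "`1, …, n` are non-zero in the field".)

## What is proved

* `CKSV2022.lemma_21_height` — **Lemma 21 in the height currency of the tree**
  (`codim = Ideal.height`, as in `ABV17SingularLocusBound`): under the corrected hypothesis, every
  prime ideal of `K[x_σ]` (`|σ| = n`) containing all `∂_i e_d` has height `≥ n − (d − 2)`; i.e. every
  irreducible component of `V` has codimension `≥ n − (d−2)`, which is "`dim V ≤ d − 2`". Proof as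
  printed, run at the generic point of the component: the images `a` of the variables in the fraction
  field `L` of `K[x]/P` form a common zero of the `∂_i e_d` over `L`, so by Claim 22 (over `L`) at
  least `n − (d−2)` of them vanish, i.e. `P` contains that many variables; a prime containing `|T|`
  variables has height `≥ |T|` (`VonZurGathen.card_le_height_ker_aeval`, the chain
  `(x_{t₁}) ⊂ (x_{t₁}, x_{t₂}) ⊂ ⋯` inside the kernel of evaluation).
* `CKSV2022.lemma_21_height_singIdeal` — the same for the singular ideal `(e_d, ∂_i e_d : i)` of
  `ABV17SingularLocusBound` (`codim Sing(e_d) ≥ n − d + 2`).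
* `CKSV2022.card_ge_of_esymm_eq_sum_mul` — the counting step of Theorem 31 in the exact case (no
  remainder), general degree: `e_{n,d} = Σ_{j∈ι} P_jQ_j + c` with a common zero of all `P_j, Q_j` forces
  `n − (d−2) ≤ 2|ι|` (Krull's height theorem above, Lemma 21 below). The robust version with a
  remainder of degree `≤ d − 1` (what Theorem 31 uses, via Lemma 24 = Gröbner degeneration) is NOT
  proved here.
* `CKSV2022.determinantalComplexity_esymm_ge` — **corollary assembled in this tree** (not claimed
  to be in print): combining Lemma 21 with Alper–Bogart–Velasco 2017, Thm. 1.2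
  (`alperBogartVelasco2017_thm_1_2_nat`, PROVED in the tree: `dc(f) ≥ codim Sing(f) + 1` for
  homogeneous `f` of degree `> 2` with `codim Sing(f) > 4`), for `3 ≤ d` and `d + 3 ≤ n` over a field
  in which `1, …, n` are non-zero: `dc(e_{n,d}) ≥ n − d + 3`. For `d = 3` this reads
  `dc(e_{n,3}) ≥ n` (`n ≥ 6`).

D-0026: no named facts; everything here is a theorem.

## References
* [ChatterjeeKumarSheVolk2022] P. Chatterjee, M. Kumar, A. She, B. L. Volk, comput. complex. 31
  (2022) 8, doi:10.1007/s00037-022-00223-8, arXiv:1911.11793 — §5.1 Lemma 21, Claim 22.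
* [AlperBogartVelasco2017] J. Alper, T. Bogart, M. Velasco, A lower bound for the determinantal
  complexity of a hypersurface, Found. Comput. Math. 17 (2017) 829–836 — Thm. 1.2 (tree:
  `ABV17SingularLocusBound`).
-/

noncomputable section

open MvPolynomial Finset

namespace Literature.Computability.AlgebraicComplexity

namespace CKSV2022

section Height

variable {K : Type*} [Field K] {σ : Type*} [Fintype σ] [DecidableEq σ]

/-- The elementary symmetric polynomial `e_d` is homogeneous of degree `d`.
[cite: ChatterjeeKumarSheVolk2022, §5.1] -/
theorem esymm_isHomogeneous (d : ℕ) : (esymm σ K d).IsHomogeneous d := by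
  rw [esymm_eq_sum_monomial]
  refine IsHomogeneous.sum _ _ _ fun t ht => isHomogeneous_monomial _ ?_
  rw [Finset.mem_powersetCard] at ht
  rw [Finsupp.degree_apply]
  have hsupp : (∑ i ∈ t, Finsupp.single i 1 : σ →₀ ℕ).support = t := by
    ext i
    simp [Finsupp.mem_support_iff, Finsupp.finsetSum_apply, Finsupp.single_apply,
      Finset.sum_ite_eq']
  rw [hsupp, ← ht.2, Finset.card_eq_sum_ones]
  refine Finset.sum_congr rfl fun i hi => ?_
  simp [Finsupp.finsetSum_apply, Finsupp.single_apply, Finset.sum_ite_eq', hi]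

/-- **CKSV 2022, Lemma 21, height form** ("the dimension of the variety
`V = 𝕍(∂_{x_i} ESYM(n,d) : i ∈ [n])` is at most `d − 2`", `2 ≤ d ≤ n`), under the corrected
hypothesis that `1, …, n` are non-zero in `K`: every prime `P ⊇ (∂_i e_d : i)` of `K[x_σ]`, `|σ| = n`,
has `height P ≥ n − (d − 2)` — every irreducible component of `V` has codimension `≥ n − (d−2)`.
Proof as printed ("`V ⊆ ∪_{|S| = d−2} V_S`") at the generic point of `V(P)`: Claim 22 over the
fraction field of `K[x]/P` puts `n − (d−2)` variables into `P`.
[cite: ChatterjeeKumarSheVolk2022, Lemma 21] -/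
theorem lemma_21_height {n d : ℕ} (hσ : Fintype.card σ = n) (hd : 2 ≤ d) (hdn : d ≤ n)
    (hK : ∀ k : ℕ, 1 ≤ k → k ≤ n → (k : K) ≠ 0) (P : Ideal (MvPolynomial σ K)) [hP : P.IsPrime]
    (hle : ∀ i, pderiv i (esymm σ K d) ∈ P) : ((n - (d - 2) : ℕ) : ℕ∞) ≤ P.height := by
  classical
  haveI : IsDomain (MvPolynomial σ K ⧸ P) := Ideal.Quotient.isDomain P
  -- the generic point of `V(P)`: the variables in `K[x]/P`, and in its fraction field
  let a : σ → MvPolynomial σ K ⧸ P := fun i => Ideal.Quotient.mk P (X i)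
  have hker : RingHom.ker (aeval (R := K) a) = P := by
    have h : (aeval (R := K) a : MvPolynomial σ K →ₐ[K] MvPolynomial σ K ⧸ P) =
        Ideal.Quotient.mkₐ K P :=
      MvPolynomial.algHom_ext fun i => by simp [a]
    ext f
    rw [RingHom.mem_ker, show aeval (R := K) a f = Ideal.Quotient.mk P f by rw [h]; rfl,
      Ideal.Quotient.eq_zero_iff_mem]
  let ψ : MvPolynomial σ K ⧸ P →+* FractionRing (MvPolynomial σ K ⧸ P) := algebraMap _ _
  have hψ : Function.Injective ψ := IsFractionRing.injective (MvPolynomial σ K ⧸ P) _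
  let a' : σ → FractionRing (MvPolynomial σ K ⧸ P) := fun i => ψ (a i)
  let φ : K →+* FractionRing (MvPolynomial σ K ⧸ P) :=
    ψ.comp ((Ideal.Quotient.mk P).comp (C : K →+* MvPolynomial σ K))
  -- evaluating at the generic point = reducing mod `P`
  have heval : ∀ g : MvPolynomial σ K, eval₂ φ a' g = ψ (Ideal.Quotient.mk P g) := by
    intro g
    have h : eval₂Hom φ a' = ψ.comp (Ideal.Quotient.mk P) := by
      refine MvPolynomial.ringHom_ext (fun c => ?_) (fun i => ?_)
      · rw [eval₂Hom_C]; rfl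
      · rw [eval₂Hom_X']; rfl
    exact RingHom.congr_fun h g
  -- `1, …, n` stay non-zero in the fraction field
  have hK' : ∀ k : ℕ, 1 ≤ k → k ≤ n → (k : FractionRing (MvPolynomial σ K ⧸ P)) ≠ 0 := by
    intro k hk1 hkn hk0
    have h1 : ψ (Ideal.Quotient.mk P (C (k : K))) = ψ 0 := by
      rw [map_zero, ← hk0, ← map_natCast φ k]; rfl
    have h2 := hψ h1
    rw [Ideal.Quotient.eq_zero_iff_mem] at h2
    have hunit : IsUnit (C (k : K) : MvPolynomial σ K) := (IsUnit.mk0 _ (hK k hk1 hkn)).map C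
    exact hP.ne_top (Ideal.eq_top_of_isUnit_mem P h2 hunit)
  -- the generic point is a common zero of the `∂_i e_d`
  have ha' : ∀ i, eval a' (pderiv i (esymm σ (FractionRing (MvPolynomial σ K ⧸ P)) d)) = 0 := by
    intro i
    rw [← map_esymm σ K d φ, pderiv_map, eval_map, heval,
      Ideal.Quotient.eq_zero_iff_mem.2 (hle i), map_zero]
  -- Claim 22 over the fraction field: the point is supported on `≤ d − 2` coordinates
  obtain ⟨S, hScard, hSa⟩ := claim_22 hσ hd hdn hK' a' ha'
  have hT : ∀ x ∈ Sᶜ, a x = 0 := fun x hx =>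
    hψ (by rw [map_zero]; exact hSa x (Finset.mem_compl.1 hx))
  -- a prime containing the variables of `Sᶜ` has height `≥ |Sᶜ|`
  have h := VonZurGathen.card_le_height_ker_aeval (K := K) a Sᶜ hT
  rw [hker, Finset.card_compl, hσ] at h
  exact le_trans (by exact_mod_cast (by omega : n - (d - 2) ≤ n - S.card)) h

/-- **Lemma 21 for the singular ideal** (`codim Sing(e_d) ≥ n − d + 2` in the currency of
`ABV17SingularLocusBound`: `codim Sing(f) = height (singIdeal f)`, `singIdeal f = (f, ∂_i f : i)`),
under the corrected hypothesis. [cite: ChatterjeeKumarSheVolk2022, Lemma 21] -/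
theorem lemma_21_height_singIdeal {n d : ℕ} (hσ : Fintype.card σ = n) (hd : 2 ≤ d) (hdn : d ≤ n)
    (hK : ∀ k : ℕ, 1 ≤ k → k ≤ n → (k : K) ≠ 0) :
    ((n - (d - 2) : ℕ) : ℕ∞) ≤ (singIdeal (esymm σ K d)).height := by
  rw [Ideal.height_eq_inf_minimalPrimes]
  refine le_iInf₂ fun P hP => ?_
  haveI := hP.1.1
  exact lemma_21_height hσ hd hdn hK P fun i => hP.1.2 (pderiv_mem_singIdeal _ i)

/-- **Corollary (assembled in this tree from Lemma 21 and Alper–Bogart–Velasco 2017, Thm. 1.2)**: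
over a field in which `1, …, n` are non-zero, for `3 ≤ d` and `d + 3 ≤ n`, the determinantal
complexity of the elementary symmetric polynomial satisfies `dc(e_{n,d}) ≥ n − d + 3`
(`e_d` is homogeneous of degree `d > 2` and `codim Sing(e_d) ≥ n − d + 2 > 4`). Not claimed to be
in print in this form; the two inputs are the cited theorems.
[cite: ChatterjeeKumarSheVolk2022, Lemma 21] [cite: AlperBogartVelasco2017, Thm. 1.2] -/
theorem determinantalComplexity_esymm_ge {n d : ℕ} (hσ : Fintype.card σ = n) (hd : 3 ≤ d)
    (hdn : d + 3 ≤ n) (hK : ∀ k : ℕ, 1 ≤ k → k ≤ n → (k : K) ≠ 0) :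
    n - d + 3 ≤ determinantalComplexity (esymm σ K d) := by
  have h := alperBogartVelasco2017_thm_1_2_nat (esymm_isHomogeneous (K := K) (σ := σ) d)
    (by omega) (c := n - (d - 2)) (by omega) (lemma_21_height_singIdeal hσ (by omega) (by omega) hK)
  omega

/-- **The counting step of CKSV Theorem 31, exact (`R = 0`) case, general degree** (TeX L893–900: "if we
consider `V = 𝕍(∂_{x_i} ESYM … )`, `V' = 𝕍(g_i, h_i, A_j, B_j)` then `V' ⊆ V` and `V' ≠ ∅` … `dim(V) ≤ d − 2`
and since `V' ≠ ∅`, `dim(V') ≥ n − 2k − 2r` (Krull) … Hence `n − 2k − 2r ≤ d − 2`"): if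
`e_{n,d} = Σ_{j ∈ ι} P_j·Q_j + c` with a constant `c` and all `P_j, Q_j` vanishing at a common point `a`,
then `n − (d − 2) ≤ 2·|ι|` (`2 ≤ d ≤ n`, `1, …, n` non-zero in `K`). Proof as printed, in heights: the
`∂_i e_d` lie in `I = (P_j, Q_j)` (product rule), a minimal prime of `I` below the point `a` has height
`≤ 2|ι|` (Krull's height theorem, `Ideal.height_le_card_of_mem_minimalPrimes_span_finset`) and height
`≥ n − (d−2)` (`lemma_21_height`). The printed theorem needs the ROBUST version (a remainder `R''` of
degree `≤ d − 1`, Lemma 24 = Gröbner degeneration), which is not proved here.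
[cite: ChatterjeeKumarSheVolk2022, Theorem 31 (proof) and Lemma 21] -/
theorem card_ge_of_esymm_eq_sum_mul {n d : ℕ} (hσ : Fintype.card σ = n) (hd : 2 ≤ d) (hdn : d ≤ n)
    (hK : ∀ k : ℕ, 1 ≤ k → k ≤ n → (k : K) ≠ 0) {ι : Type*} [Fintype ι]
    (P Q : ι → MvPolynomial σ K) (c : K) (a : σ → K)
    (ha : ∀ j, eval a (P j) = 0 ∧ eval a (Q j) = 0)
    (h : esymm σ K d = ∑ j, P j * Q j + C c) : n - (d - 2) ≤ 2 * Fintype.card ι := by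
  classical
  -- the ideal `I = (P_j, Q_j : j)` and the maximal ideal of the point `a`
  let s : Finset (MvPolynomial σ K) := Finset.univ.image P ∪ Finset.univ.image Q
  let I : Ideal (MvPolynomial σ K) := Ideal.span (s : Set _)
  let 𝔪 : Ideal (MvPolynomial σ K) := RingHom.ker (eval a : MvPolynomial σ K →+* K)
  have hscard : s.card ≤ 2 * Fintype.card ι := by
    refine (Finset.card_union_le _ _).trans ?_
    have h1 := Finset.card_image_le (s := Finset.univ) (f := P)
    have h2 := Finset.card_image_le (s := Finset.univ) (f := Q)
    rw [Finset.card_univ] at h1 h2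
    omega
  have hPI : ∀ j, P j ∈ I := fun j => Ideal.subset_span (Finset.mem_coe.2
    (Finset.mem_union_left _ (Finset.mem_image_of_mem _ (Finset.mem_univ j))))
  have hQI : ∀ j, Q j ∈ I := fun j => Ideal.subset_span (Finset.mem_coe.2
    (Finset.mem_union_right _ (Finset.mem_image_of_mem _ (Finset.mem_univ j))))
  have hI𝔪 : I ≤ 𝔪 := by
    rw [Ideal.span_le]
    intro g hg
    rw [SetLike.mem_coe, RingHom.mem_ker]
    rcases Finset.mem_union.1 (Finset.mem_coe.1 hg) with hg | hg
    · obtain ⟨j, -, rfl⟩ := Finset.mem_image.1 hg; exact (ha j).1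
    · obtain ⟨j, -, rfl⟩ := Finset.mem_image.1 hg; exact (ha j).2
  -- product rule: `∂_i e_d ∈ I`
  have hderiv : ∀ i, pderiv i (esymm σ K d) ∈ I := by
    intro i
    rw [h, map_add, pderiv_C, add_zero, map_sum]
    refine Ideal.sum_mem _ fun j _ => ?_
    rw [Derivation.leibniz, smul_eq_mul, smul_eq_mul]
    exact Ideal.add_mem _ (Ideal.mul_mem_right _ _ (hPI j)) (Ideal.mul_mem_right _ _ (hQI j))
  -- a minimal prime of `I` below `𝔪`: Krull above, Lemma 21 below
  haveI h𝔪max : 𝔪.IsMaximal :=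
    RingHom.ker_isMaximal_of_surjective (eval a) fun c => ⟨C c, eval_C c⟩
  obtain ⟨𝔭, h𝔭min, -⟩ := Ideal.exists_minimalPrimes_le hI𝔪
  haveI h𝔭prime : 𝔭.IsPrime := h𝔭min.1.1
  have hKrull : 𝔭.height ≤ s.card := Ideal.height_le_card_of_mem_minimalPrimes_span_finset h𝔭min
  have hlow := lemma_21_height hσ hd hdn hK 𝔭 fun i => h𝔭min.1.2 (hderiv i)
  have hfin : ((n - (d - 2) : ℕ) : ℕ∞) ≤ ((2 * Fintype.card ι : ℕ) : ℕ∞) :=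
    hlow.trans (hKrull.trans (by exact_mod_cast hscard))
  exact_mod_cast hfin

end Height

end CKSV2022

end Literature.Computability.AlgebraicComplexity

end
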